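import Summits.BirchSwinnertonDyer.BirchSwinnertonDyer.Theorems.QuadraticBranchSignedControlEtaTransportLocalModelChange
import Literature.NumberTheory.GaloisRepresentations.PadicAlgebraDegreeOnePlace
import Mathlib.NumberTheory.Padics.HeightOneSpectrum
import HarnessLib

/-!
# Route `QuadraticBranchSignedControl` (rung K8, cell `bsd-potss`), crux `EtaTransportSigned`
# (item stmt-BirchSwinnertonDyer-19115), frame (i-f)₂ COMPLETED: p17/Kobayashi's plus Selmer group
# `Sel^{+,str}(E/K_∞)` does not depend on the model of the completion at `p`; in particular
# `strictSignedSelmerInfty V κ ℚ_{v₀} 1 = strictSignedSelmerInfty V κ ℚ_[p] 1`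

WHAT. Continuation of `…EtaTransportLocalModelChange.lean` (bricks 1–2: layer subgroups / layer
points / traces / signed points correspond along a `K`-algebra map of isomorphic models `E₁ → E₂`;
the Kummer condition moves by `conj_τ`). Here:
* §3 `conjH1_inv_mem_localKummerOverOfEmb_of_map` — the reverse Kummer transport (by `conj_{τ⁻¹}`;
  `J` bijective, `r` onto);
* §4 `strictSignedSelmerLayer_one_eq_of_models`, `strictSignedSelmerInfty_one_eq_of_models` —
  **the plus Selmer groups at two isomorphic models COINCIDE** (the classical part is model-free;
  the family of plus Kummer conditions over all `Γ_K`-conjugates of `ι_{E₂}` is the family over all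
  conjugates of `ι_{E₁}`, `conj_σ ↦ conj_{τσ}`);
* §5 `strictSignedSelmerInfty_one_adicCompletion_eq_padic` — the instance `ℚ_{v₀} ≃ ℚ_[p]`
  (Mathlib's continuous `ℚ`-algebra isomorphism `Rat.HeightOneSpectrum.adicCompletion.padicEquiv`,
  read as an `Algebra` structure: surjective, scalar tower over `ℚ`, algebraic).
With `signedSelmerInfty_one_eq_strictSignedSelmerInfty_adicCompletion` (`…EtaTransportSelmerAdicModel.lean`)
this DISCHARGES the frame (i-f) of `…EtaTransportDecompositionOfFrames.lean`
(`Kobayashi2003.signedSelmerInfty V κ 1 = strictSignedSelmerInfty V κ ℚ_[p] 1`), leaving (A)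
(the `F`-internal ↔ `ℚ`-internal comparison, ctrl's (i-c)) as the only displayed frame under the
plus stub of the crux.

HONEST FRAMING (cell `bsd-potss`, run/shared/lean/pub/bsd-potss/; FULL-BSD rank ≤ 1 programme):
TOOL THEOREMS ONLY — no definition, no named Literature fact, no `sorry`, axioms standard;
UNCONDITIONAL. Nothing about (C1_η), Kobayashi's theorems or `BSD(W, p)` is claimed; no label or
count moves. Seat `bsd-potss-k8q-c3` (prover), g0.

References: [Kobayashi2003] Def. 1.1 (p. 2), Def. 2.1 (p. 5); [GreenbergLNM1716] §2 (conjugate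
decomposition groups give the same local condition); [SerreGaloisCohomology1997] I.§2.5, II.§1.1.
-/

set_option autoImplicit false
set_option linter.dupNamespace false

noncomputable section

open scoped Classical

open Field WeierstrassCurve
open Literature.NumberTheory.EllipticCurves
open Literature.NumberTheory.GaloisRepresentations
open Summit.BirchSwinnertonDyer.Rank1Residual.Additive

namespace Summit.BirchSwinnertonDyer.BirchSwinnertonDyer.Theorems

/-! ## §3 The reverse direction (isomorphic models) -/

section Reverse

variable {K : Type} [Field K] (W : WeierstrassCurve K) {p : ℕ}
  (E₁ E₂ : Type) [Field E₁] [Field E₂] [Algebra K E₁] [Algebra K E₂] [Algebra E₁ E₂]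
  [IsScalarTower K E₁ E₂] [Algebra.IsAlgebraic E₁ E₂]

/-- **The Kummer condition, reverse direction (isomorphic models)**: if `c` satisfies the Kummer
condition at `E₂` for `J(A)`, then `conj_{τ⁻¹} c` satisfies it at `E₁` for `A` — `J` is bijective
(`exists_map_eq_localPoints`, `Point.map_injective`) and `r` is onto, so the point and the local
elements lift. [cite: Kobayashi2003, Def. 1.1 (p. 2) and §2 p. 4] [cite: SerreGaloisCohomology1997, I.§2.5, II.§1.1] -/
theorem conjH1_inv_mem_localKummerOverOfEmb_of_map (hs : Function.Surjective (algebraMap E₁ E₂))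
    (H : Subgroup (absoluteGaloisGroup K)) [H.Normal] {τ : absoluteGaloisGroup K}
    (hτ : ∀ x : AlgebraicClosure K,
      absClosureEmbedding K E₂ (τ • x) = absClosureEmbedding E₁ E₂ (absClosureEmbedding K E₁ x))
    (A : AddSubgroup (localPoints W E₁)) {c : W.subgroupH1 p H}
    (hc : c ∈ Kobayashi2003.localKummerOverOfEmb W p H (closureEmb (K := K) E₂)
      (A.map (show localPoints W E₁ →+ localPoints W E₂ from
        Affine.Point.map (W' := W) ((absClosureEmbedding E₁ E₂).restrictScalars K)))) :
    W.conjH1 p H τ⁻¹ c ∈ Kobayashi2003.localKummerOverOfEmb W p H (closureEmb (K := K) E₁) A := by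
  set J : localPoints W E₁ →+ localPoints W E₂ :=
    (show localPoints W E₁ →+ localPoints W E₂ from
      Affine.Point.map (W' := W) ((absClosureEmbedding E₁ E₂).restrictScalars K)) with hJ
  have hJs : ∀ (σ : absoluteGaloisGroup E₂) (R : localPoints W E₁),
      J (absGaloisRestrict E₁ E₂ σ • R) = σ • J R := fun σ R => by
    rw [localPoints.smul_def W E₂ σ (J R)]
    exact LocalModelTransport.map_smul_localPoints W E₁ E₂ σ R
  have hJι : ∀ P : geomPoints W,
      pointsMapOfEmb W (closureEmb (K := K) E₂) (τ • P) = J (pointsMapOfEmb W (closureEmb (K := K) E₁) P) :=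
    fun P => LocalModelTransport.pointsMap_smul_eq_map_pointsMap W E₁ E₂ hτ P
  have hJinj : Function.Injective J :=
    Affine.Point.map_injective (W' := W) ((absClosureEmbedding E₁ E₂).restrictScalars K)
  have hconj := LocalModelTransport.absGaloisRestrict_absGaloisRestrict_eq_conj K E₁ E₂ hτ
  obtain ⟨φ, Q₂, k, rfl, hA, hloc⟩ := hc
  obtain ⟨Q₁, rfl⟩ : ∃ Q₁ : localPoints W E₁, J Q₁ = Q₂ :=
    LocalModelTransport.exists_map_eq_localPoints W E₁ E₂ Q₂
  have hA₁ : p ^ k • Q₁ ∈ A := by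
    obtain ⟨a, ha, hJa⟩ := AddSubgroup.mem_map.mp hA
    rw [← map_nsmul] at hJa
    rwa [← hJinj hJa]
  refine ⟨conjCocycle H τ⁻¹ φ, Q₁, k, (conjH1_oneCocycleClass H τ⁻¹ φ).symm, hA₁, fun t₁ => ?_⟩
  -- lift the local element along `r`
  obtain ⟨t₂, ht₂⟩ := LocalModelTransport.absGaloisRestrict_surjective_of_surjective E₁ E₂ hs
    (t₁ : absoluteGaloisGroup E₁)
  have h1 : absGaloisRestrict K E₁ (t₁ : absoluteGaloisGroup E₁) ∈ H := by
    have h := t₁.2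
    rw [mem_localSubgroupOfEmb_iff, ← resGal_eq] at h
    exact h
  have h2 : absGaloisRestrict K E₂ t₂ = τ * absGaloisRestrict K E₁ (t₁ : absoluteGaloisGroup E₁) * τ⁻¹ := by
    rw [← ht₂, hconj t₂, ← mul_assoc, ← mul_assoc, mul_inv_cancel, one_mul, mul_assoc,
      mul_inv_cancel, mul_one]
  have ht₂H : t₂ ∈ localSubgroupOfEmb H (closureEmb (K := K) E₂) := by
    rw [mem_localSubgroupOfEmb_iff, ← resGal_eq]
    change absGaloisRestrict K E₂ t₂ ∈ H
    rw [h2]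
    exact ‹H.Normal›.conj_mem _ h1 τ
  have key := hloc ⟨t₂, ht₂H⟩
  have hsub : subgroupConj H τ⁻¹ (resGalSubgroupOfEmb H (closureEmb (K := K) E₁) t₁) =
      resGalSubgroupOfEmb H (closureEmb (K := K) E₂) ⟨t₂, ht₂H⟩ := by
    apply Subtype.ext
    rw [subgroupConj_apply_coe, inv_inv]
    change τ * resGalOfEmb (closureEmb (K := K) E₁) t₁ * τ⁻¹ = resGalOfEmb (closureEmb (K := K) E₂) t₂
    rw [← resGal_eq, ← resGal_eq]
    exact h2.symm
  apply hJinj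
  rw [conjCocycle_apply, hsub, primaryComponent.coe_smul, ← hJι, smul_inv_smul, key, map_sub,
    ← hJs, ht₂]

end Reverse

/-! ## §4 The plus Selmer groups at two isomorphic models coincide -/

section Selmer

variable {K : Type} [Field K] [NumberField K] (W : WeierstrassCurve K) {p : ℕ} [Fact p.Prime]
  (κ : ZpExtension K p) (E₁ E₂ : Type) [Field E₁] [Field E₂] [Algebra K E₁] [Algebra K E₂]
  [Algebra E₁ E₂] [IsScalarTower K E₁ E₂] [Algebra.IsAlgebraic E₁ E₂]

omit [NumberField K] in
/-- `J(E^ε(K_n·E₁)) = E^ε(K_n·E₂)` for isomorphic models (`J` onto, `map_mem_signedLocalPointsOfEmb_iff`).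
[cite: Kobayashi2003, Def. 1.1 (p. 2)] -/
theorem map_signedLocalPointsOfEmb_eq (hs : Function.Surjective (algebraMap E₁ E₂))
    {τ : absoluteGaloisGroup K}
    (hτ : ∀ x : AlgebraicClosure K,
      absClosureEmbedding K E₂ (τ • x) = absClosureEmbedding E₁ E₂ (absClosureEmbedding K E₁ x))
    (ε : ℤˣ) (n : ℕ) :
    (Kobayashi2003.signedLocalPointsOfEmb κ (closureEmb (K := K) E₁) W ε n).map
        (show localPoints W E₁ →+ localPoints W E₂ from
          Affine.Point.map (W' := W) ((absClosureEmbedding E₁ E₂).restrictScalars K)) =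
      Kobayashi2003.signedLocalPointsOfEmb κ (closureEmb (K := K) E₂) W ε n := by
  ext P
  rw [AddSubgroup.mem_map]
  constructor
  · rintro ⟨Q, hQ, rfl⟩
    exact (map_mem_signedLocalPointsOfEmb_iff W κ E₁ E₂ hs hτ ε n Q).mpr hQ
  · intro hP
    obtain ⟨Q, rfl⟩ : ∃ Q : localPoints W E₁,
        (show localPoints W E₁ →+ localPoints W E₂ from
          Affine.Point.map (W' := W) ((absClosureEmbedding E₁ E₂).restrictScalars K)) Q = P :=
      LocalModelTransport.exists_map_eq_localPoints W E₁ E₂ P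
    exact ⟨Q, (map_mem_signedLocalPointsOfEmb_iff W κ E₁ E₂ hs hτ ε n Q).mp hP, rfl⟩

/-- **`Sel^{+,str}(E/K_n)` does not depend on the model of the completion** (isomorphic models
`E₁ → E₂`): the classical part is model-free, and the family of plus Kummer conditions at all
`Γ_K`-conjugates of `ι_{E₂}` is the family at all conjugates of `ι_{E₁}` — the condition at `E₂`
is `conj_τ` of the condition at `E₁` (§§2–3), and `conj_σ ↦ conj_{τσ}` permutes the family.
[cite: Kobayashi2003, Def. 1.1 (p. 2), Def. 2.1 (p. 5)] [cite: GreenbergLNM1716, §2 (conjugate decomposition groups)] -/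
theorem strictSignedSelmerLayer_one_eq_of_models (hs : Function.Surjective (algebraMap E₁ E₂))
    (n : ℕ) : strictSignedSelmerLayer W κ E₁ 1 n = strictSignedSelmerLayer W κ E₂ 1 n := by
  obtain ⟨τ, hτ⟩ := LocalModelTransport.exists_smul_absClosureEmbedding_eq K E₁ E₂
  ext c
  rw [mem_strictSignedSelmerLayer_iff, mem_strictSignedSelmerLayer_iff]
  refine and_congr_right fun _ => ?_
  simp only [strictSignedLocalPoints, strictSignedLocalPointsOfEmb_one]
  rw [← map_signedLocalPointsOfEmb_eq W κ E₁ E₂ hs hτ 1 n]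
  constructor
  · intro h σ
    have h' := conjH1_mem_localKummerOverOfEmb_map W E₁ E₂ (κ.layerSubgroup n) hτ _ (h (τ⁻¹ * σ))
    rwa [← AddMonoidHom.comp_apply, ← W.conjH1_mul_holds p (κ.layerSubgroup n) τ (τ⁻¹ * σ),
      mul_inv_cancel_left] at h'
  · intro h σ
    have h' := conjH1_inv_mem_localKummerOverOfEmb_of_map W E₁ E₂ hs (κ.layerSubgroup n) hτ _
      (h (τ * σ))
    rwa [← AddMonoidHom.comp_apply, ← W.conjH1_mul_holds p (κ.layerSubgroup n) τ⁻¹ (τ * σ),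
      inv_mul_cancel_left] at h'

/-- **`Sel^{+,str}(E/K_∞)` does not depend on the model of the completion** (isomorphic models).
[cite: Kobayashi2003, Def. 1.1 (p. 2), Def. 2.1 (p. 5)] -/
theorem strictSignedSelmerInfty_one_eq_of_models (hs : Function.Surjective (algebraMap E₁ E₂)) :
    strictSignedSelmerInfty W κ E₁ 1 = strictSignedSelmerInfty W κ E₂ 1 := by
  unfold strictSignedSelmerInfty
  congr 1
  ext n : 1
  rw [strictSignedSelmerLayer_one_eq_of_models W κ E₁ E₂ hs n]

end Selmer

/-! ## §5 The instance: `ℚ_{v₀} ≃ ℚ_[p]` (Mathlib's `padicEquiv`) -/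

/-- **(i-f)₂ for the crux: `strictSignedSelmerInfty V κ ℚ_{v₀} 1 = strictSignedSelmerInfty V κ ℚ_[p] 1`**
for the place `v₀` of `ℚ` above `p` — §4 along Mathlib's continuous `ℚ`-algebra isomorphism
`Rat.HeightOneSpectrum.adicCompletion.padicEquiv v₀ : ℚ_{v₀} ≃ ℚ_[p]` (made an `Algebra` structure;
surjective, scalar tower over `ℚ`, algebraic). Together with
`signedSelmerInfty_one_eq_strictSignedSelmerInfty_adicCompletion` (`…EtaTransportSelmerAdicModel.lean`)
this discharges the frame (i-f) of `…EtaTransportDecompositionOfFrames.lean`.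
[cite: Kobayashi2003, Def. 1.1 (p. 2) ("F_{n,p} is the completion of F_n at the place over p")] -/
theorem strictSignedSelmerInfty_one_adicCompletion_eq_padic (V : WeierstrassCurve ℚ) {p : ℕ}
    [Fact p.Prime] (κ : ZpExtension ℚ p) (v₀ : IsDedekindDomain.HeightOneSpectrum (NumberField.RingOfIntegers ℚ))
    (hv₀ : ((p : ℕ) : NumberField.RingOfIntegers ℚ) ∈ v₀.asIdeal) :
    strictSignedSelmerInfty V κ (v₀.adicCompletion ℚ) 1 = strictSignedSelmerInfty V κ ℚ_[p] 1 := by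
  have hpeq := LocalField.primesEquiv_eq_of_natCast_mem p v₀ hv₀
  subst hpeq
  let e := Rat.HeightOneSpectrum.adicCompletion.padicEquiv (R := NumberField.RingOfIntegers ℚ) v₀
  letI : Algebra (v₀.adicCompletion ℚ) ℚ_[((Rat.HeightOneSpectrum.primesEquiv v₀ : Nat.Primes) : ℕ)] :=
    (e.toAlgEquiv : v₀.adicCompletion ℚ →ₐ[ℚ] _).toRingHom.toAlgebra
  have halg : ∀ x : v₀.adicCompletion ℚ,
      algebraMap (v₀.adicCompletion ℚ) ℚ_[((Rat.HeightOneSpectrum.primesEquiv v₀ : Nat.Primes) : ℕ)] x =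
        e x := fun x => rfl
  haveI : IsScalarTower ℚ (v₀.adicCompletion ℚ)
      ℚ_[((Rat.HeightOneSpectrum.primesEquiv v₀ : Nat.Primes) : ℕ)] :=
    IsScalarTower.of_algebraMap_eq fun x => by
      rw [halg]; exact ((e.toAlgEquiv).commutes x).symm
  have hs : Function.Surjective
      (algebraMap (v₀.adicCompletion ℚ) ℚ_[((Rat.HeightOneSpectrum.primesEquiv v₀ : Nat.Primes) : ℕ)]) :=
    fun y => ⟨e.symm y, by rw [halg]; exact e.apply_symm_apply y⟩
  haveI : Algebra.IsAlgebraic (v₀.adicCompletion ℚ)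
      ℚ_[((Rat.HeightOneSpectrum.primesEquiv v₀ : Nat.Primes) : ℕ)] :=
    ⟨fun y => by obtain ⟨x, rfl⟩ := hs y; exact isAlgebraic_algebraMap x⟩
  exact strictSignedSelmerInfty_one_eq_of_models V κ _ _ hs

end Summit.BirchSwinnertonDyer.BirchSwinnertonDyer.Theorems

end
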